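import Literature.MathematicalPhysics.QuantumFieldTheory.Balaban1983to89.B8SockLettersRange

/-!
# `Balaban1983to89.B8SockLettersRD` — [Balaban1985RegularSpaces] Sect. D (1.91)–(1.103) pp. 91–93: THE [4]-LETTERS SOCKET of the N05 knit WITH THE INVERSE LAWS ON PRINT'S
# DOMAINS — `G′` the inverse of `Δ_{Ω₀} + Q′ᵀ𝔄Q′` ON FUNCTIONS ON THE REGION `Ω₀` ([4] Thm 3.1, (1.95)) and `C` the inverse of `Q′G′²Q′ᵀ` ON THE RANGE OF `Q′` ((3.25)); the
# second pass of the W8 junction repair (`SockLetters` p454033 → `SockLettersR` p462570 → this file)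

statement-level skeleton of published theorems with citation tags; proofs where landed; nothing here is a claim about the
Yang–Mills mass gap

PDF held: `paper:balaban1985-cmp99-regular-spaces-gauge-fixing` (journal page = PDF page + 74); pp. 91–94 ((1.86)–(1.106)).  [4] = [Balaban1985BackgroundPropagators]
(Thm 3.1 p. 397, Thms 3.2–3.3 pp. 397–398, (3.23)–(3.25) p. 394).

WHY THIS FILE (cell `pub-ymgap`, R134 acceleration seat `pub-ymgap-dag-n05-d` (g2), strategy s2 of DAG node N05 = [B8]; dag-lead REBALANCE №56 (a); count-neutral).  Referee
dag-ref-A g12's flags W8 (READ-7/READ-11) and W8′ (READ-15), both kernel-certified: the letters sockets `SockLetters` and `SockLettersR` type [4]'s operators as `ℂ`-linear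
maps on ALL functions `ℤᵈ → 𝔸` and state the inverse laws as TOTAL identities — `g_left : ∀ x, G′(Δx + Q′ᵀ𝔄Q′x) = x`, `g_right : ∀ x, Δ(G′x) + Q′ᵀ𝔄Q′(G′x) = x`, and (in
`SockLetters`) `c_right : ∀ φ, Q′G′²Q′ᵀ(Cφ) = φ`.  Together with the displayed Dirichlet range `G′f = 0 off Ω₀` each of these is FALSE at every member with finite `Ω₀` over
`ℂ` (`G′` would be a bijection between an infinite- and a finite-dimensional space), so no provider can serve the socket at the cube members.  In print `G′` is the inverse
of `Δ + Q′ᵀ𝔄Q′` with Dirichlet conditions ON FUNCTIONS ON `Ω₀` and `C` inverts `Q′G′²Q′ᵀ` on functions ON `𝔅_k`.  LOCATED (this seat, INBOX «W8″»): the total LEFT-inverse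
law is unsatisfiable even at `Ω₀ = ℤᵈ` (a finite-range periodic `Δ + Q′ᵀ𝔄Q′` has exponentially growing Bloch null vectors on all of `ℤᵈ → 𝔸`), and the existence chain never
uses it; the RIGHT-inverse law is used at exactly two points and only after EVALUATION AT SITES OF `Ω₀` (`B8Prop5JoinSectELocalRange` :239/:262, :271/:274).  THIS FILE
therefore types the socket with: NO left-inverse law; the right-inverse law POINTWISE ON `Ω₀` — `∀ x, ∀ y ∈ Ω₀, (Δ(G′x) + Q′ᵀ𝔄Q′(G′x))(y) = x(y)`; the law of `C` in range
form (as `SockLettersR`); every other conjunct byte-identical with `SockLetters`.  Satisfiability audit at a finite-`Ω₀` member (bookkeeping, not a proof): `G′ := G′₀ ∘ 𝟙_{Ω₀}`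
with `G′₀` the inverse of the compression of `Δ + Q′ᵀ𝔄Q′` to `{f ∣ f = 0 off Ω₀}` meets the pointwise law, the Dirichlet range and reality; `Q′ := 0` off `𝔅_n` with `C` the
inverse of `Q′G′²Q′ᵀ` on functions on `𝔅_n` meets the range-form law and the reading; `H′` with prescribed tower averages inside `Ω₀` meets `Q′H′ = 1` and its range law;
`Δ`, `Q′ᵀ` are pinned on `Ω₀` only; the remaining conjuncts are the inequalities (1.92), (1.98), (1.101) with the socket's constants — [4] Thms 3.1–3.3's content.  The
sibling modules `B8Prop5JoinSectELocalRD`, `B8SockHFPRD`, `B8LeafKnitZd3LettersRD` re-run the Sect. D/E JOIN, the `SockHFP` providers and the N05 knit on this socket.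

HONEST SCOPE.  A definition (a `Prop`), nothing else; nothing of [4] is asserted or proved.  Count-neutral; N05 NOT discharged; one finite T⁴ programme at fixed ε; nothing
continuum / ℝ⁴ / OS / mass-gap / Clay.  Unit `pub-ymgap-dag-n05-d` (g2), 2026-08-26.  No `instance`, no `notation`.
-/


noncomputable section

open NormedSpace

namespace Literature.MathematicalPhysics.QuantumFieldTheory.Balaban1983to89.B8SockLettersRD

open B7Prop2Explicit (unitaryUnits)
open B7Eq78Linearization (zdBlocking QprimeIter)
open B8Ineq132 (covDerivFwd InAk)
open B8Eq119TwistedAxial (bgT)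
open B8Eq140Level (SideTouches)
open B8Eq138LandauZd (covLap QT)
open B8Eq1117Concrete (XSpace)
open B8Prop5ContractionKLevel (Bd2)
open B8LambdaSpaceKLevel (wt)

variable {d : ℕ}

section Letters

variable {𝔸 : Type*} [CStarAlgebra 𝔸]

/-- **THE [4]-LETTERS SOCKET WITH THE INVERSE LAWS ON PRINT'S DOMAINS** at a member `(η, k, {Ω_j}, {Λs n})` of the general-background `ℤᵈ × 𝔸` family, constants `B_G` ((1.101)),
`B_R` ((1.98)), `B₀′_H`, `B₂′` ((1.92)), threshold `cP`: for every `0 < α₀ ≤ cP`, every unitary background `U₀ ∈ 𝔄_k({Ω_j}, α₀)` and every truncation level `1 ≤ n ≤ k`, `ℂ`-linear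
LETTERS `g = G′`, `Δ`, `q = Q′`, `qs = Q′ᵀ`, `Aw = 𝔄`, `c = C`, `H′` with SIXTEEN laws: the right-inverse law of `G′` POINTWISE ON `Ω₀` («`(Δ + Q′ᵀ𝔄Q′)G′x = x` at every site of
`Ω₀`», [4] Thm 3.1: `G′` inverts the Dirichlet operator on functions on the region); the law of `C` ON THE RANGE OF `Q′` («`Q′G′²Q′ᵀC(Q′f) = Q′f`», [4] (3.25)); then VERBATIM
conjuncts 4–17 of `B8LeafModelZdSockLetters.SockLetters` — the readings «`Δ` is the covariant Laplacian on `Ω₀`-supported functions», «`Q′ᵀ` is `QT` at `(n, Λs n)`», «`Q′` is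
the iterated average at the tower sites of `Λs n`»; (1.92) for `H′`, `H′X = 0` off `Ω₀`, reality of `H′`, `Q′H′X = X` at the tower sites; (1.101) for `G′`, `G′f = 0` off `Ω₀`,
reality of `G′`; (1.98) for `R = 1 − G′Q′ᵀCQ′G′` and reality of `R`.  NO total left-inverse law (unused by the existence chain; unservable on `ℤᵈ → 𝔸`, INBOX W8″).  [4] Thms
3.1–3.3 for Bałaban's operators, as ONE hypothesis per member; nothing asserted. [cite: Balaban1985RegularSpaces, (1.91)–(1.92) p.91, (1.95)–(1.98) p.92, (1.101)–(1.103) p.93; Balaban1985BackgroundPropagators, Thm 3.1 p.397, (3.25) p.394, Thms 3.2–3.3 pp.397–398] -/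
def SockLettersRD (L : ℕ) (BG BR B₀'H B₂' cP : ℝ) (η : ℝ) (k : ℕ) (Ω : ℕ → Set (B7Prop1Explicit.Site d)) (Λs : ℕ → ℕ → Set (B7Prop1Explicit.Site d)) : Prop :=
  ∀ α₀ : ℝ, 0 < α₀ → α₀ ≤ cP → ∀ U₀ : B7Prop1Explicit.Site d → Fin d → 𝔸ˣ, (∀ x κ, U₀ x κ ∈ unitaryUnits 𝔸) → InAk L k η α₀ Ω U₀ →
    ∀ n : ℕ, 1 ≤ n → n ≤ k →
      ∃ (g Δ : (B7Prop1Explicit.Site d → 𝔸) →ₗ[ℂ] (B7Prop1Explicit.Site d → 𝔸)) (q : (B7Prop1Explicit.Site d → 𝔸) →ₗ[ℂ] (ℕ → B7Prop1Explicit.Site d → 𝔸)) (qs : (ℕ → B7Prop1Explicit.Site d → 𝔸) →ₗ[ℂ] (B7Prop1Explicit.Site d → 𝔸))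
        (Aw c : (ℕ → B7Prop1Explicit.Site d → 𝔸) →ₗ[ℂ] (ℕ → B7Prop1Explicit.Site d → 𝔸)) (H' : XSpace d n 𝔸 →ₗ[ℂ] (B7Prop1Explicit.Site d → 𝔸)),
        (∀ x, ∀ y ∈ Ω 0, (Δ (g x) + qs (Aw (q (g x)))) y = x y) ∧ (∀ f, q (g (g (qs (c (q f))))) = q f) ∧
        (∀ (f : B7Prop1Explicit.Site d → 𝔸), ∀ x ∈ Ω 0, Δ f x = covLap η U₀ ((Ω 0).indicator f) x) ∧
        (∀ (μ : ℕ → B7Prop1Explicit.Site d → 𝔸), ∀ x ∈ Ω 0, qs μ x = QT L n (Λs n) U₀ μ x) ∧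
        (∀ (f : B7Prop1Explicit.Site d → 𝔸) (j : ℕ), j ≤ n → ∀ y ∈ Λs n j, q f j y = QprimeIter (zdBlocking d L) (bgT L U₀) j f y) ∧
        (∀ (X : XSpace d n 𝔸) (x : B7Prop1Explicit.Site d), ‖H' X x‖ ≤ B₀'H * ‖X‖) ∧
        (∀ j, j ≤ n → ∀ (X : XSpace d n 𝔸), ∀ p ∈ {b : B7Prop1Explicit.Site d × Fin d | SideTouches (Ω j) b.1 b.2},
          wt L η j * ‖covDerivFwd η U₀ p.2 (H' X) p.1‖ ≤ B₀'H * ‖X‖) ∧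
        (∀ X : XSpace d n 𝔸, Bd2 L η n Ω (covLap η U₀ (H' X)) (B₂' * ‖X‖)) ∧
        (∀ (X : XSpace d n 𝔸) (x : B7Prop1Explicit.Site d), x ∉ Ω 0 → H' X x = 0) ∧
        (∀ X Y : XSpace d n 𝔸, (∀ p, Y p = -star (X p)) → ∀ x, H' Y x = -star (H' X x)) ∧
        (∀ (Y : XSpace d n 𝔸) (j : ℕ) (hj : j ≤ n) (y : B7Prop1Explicit.Site d), y ∈ Λs n j →
          QprimeIter (zdBlocking d L) (bgT L U₀) j (H' Y) y = Y (⟨j, Nat.lt_succ_of_le hj⟩, y)) ∧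
        (∀ (f : B7Prop1Explicit.Site d → 𝔸) (r : ℝ), 0 ≤ r → Bd2 L η n Ω f r →
          (∀ x, ‖g f x‖ ≤ BG * r) ∧ ∀ j, j ≤ n → ∀ p ∈ {b : B7Prop1Explicit.Site d × Fin d | SideTouches (Ω j) b.1 b.2},
            wt L η j * ‖covDerivFwd η U₀ p.2 (g f) p.1‖ ≤ BG * r) ∧
        (∀ (f : B7Prop1Explicit.Site d → 𝔸) (x : B7Prop1Explicit.Site d), x ∉ Ω 0 → g f x = 0) ∧
        (∀ f : B7Prop1Explicit.Site d → 𝔸, (∀ j, j ≤ n → ∀ x ∈ Ω j, IsSelfAdjoint (f x)) → ∀ x, IsSelfAdjoint (g f x)) ∧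
        (∀ (f : B7Prop1Explicit.Site d → 𝔸) (r : ℝ), 0 ≤ r → Bd2 L η n Ω f r → Bd2 L η n Ω (f - g (qs (c (q (g f))))) (BR * r)) ∧
        (∀ f : B7Prop1Explicit.Site d → 𝔸, (∀ j, j ≤ n → ∀ x ∈ Ω j, IsSelfAdjoint (f x)) →
          ∀ j, j ≤ n → ∀ x ∈ Ω j, IsSelfAdjoint ((f - g (qs (c (q (g f))))) x))

end Letters

end Literature.MathematicalPhysics.QuantumFieldTheory.Balaban1983to89.B8SockLettersRD

end
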